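import Literature.RingTheory.MvPolynomial.NoetherFormsSubstitution
import Mathlib.FieldTheory.Separable
import Mathlib.FieldTheory.IsAlgClosed.Basic
import Mathlib.Algebra.MvPolynomial.NoZeroDivisors
import Mathlib.RingTheory.Polynomial.UniqueFactorization
import Mathlib.RingTheory.UniqueFactorizationDomain.GCDMonoid
import Mathlib.RingTheory.MvPolynomial.WeightedHomogeneous
import Mathlib.FieldTheory.Perfect
import Mathlib.RingTheory.Localization.Ideal
import Mathlib.Algebra.MvPolynomial.PDeriv
import Mathlib.Algebra.CharP.Lemmas
import HarnessLib

/-!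
# Effective Noether forms, Stage II (continued): specialisation of the generic substitution,
# and the effective-Hilbert-irreducibility inputs (Kaltofen's Lemmas 2–5, existence part)

This file has two parts, each with its own module docstring: PART 1 (specialisation `evF`, `sT`,
`bT`, the rescaling identity, resultant/separability facts) directly below; PART 2 (renaming and
graded factors, Claim A, Lemma 3 = separability of the univariate translate, Lemma 4 = existence of
a good parameter point) starts at the second module docstring.

## Part 1: specialisation of the generic substitution

Support file for the proof of Kaltofen's Theorem 7 (`kaltofen1995_thm7`; E. Kaltofen, *Effective
Noether irreducibility forms and applications*, J. Comput. System Sci. 50 (1995) 274–295, §5,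
proof of Thm. 7: "Take a specific `f` and substitute its coefficients `q_e` for the `c_e` into all
`Φ_t` …"). We evaluate the generic objects of `NoetherFormsSubstitution` at a specific polynomial
`f ∈ T[X₁, …, Xₙ]` of total degree `≤ d` (coefficient variables `c_e ↦ coeff e f`) and a specific
parameter point `p` (`v, w, z ↦ p`), through `evF p q : 𝔼 n →+* T`:

* `fgen ↦ f` (`map_evF_fgen`), `Φgen ↦ φ_p := f(x + v₀, w₁x + z₁y + v₁, …)` (`map_evF_Φgen`), the
  coefficients, `λ`, `bgen ↦ bT`, `Pbar ↦ Res_{d,d}(ψ_{p,0}, ψ_{p,0}')`, `tauR d bgen t ↦ tauR d bT t`;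
* the total-degree bookkeeping `TDeg` on `T[y][x]` (`φ_p` has total degree `≤ d`);
* the RESCALING IDENTITY `psi d bT = λ^{d-1} φ_p(x/λ, y)` (`psi_bT_eq`) for `λ ≠ 0`, whence
  `psi d bT` is irreducible iff `φ_p` is (`irreducible_psi_bT_iff`) — this is how the monic
  polynomial of Stage I is tied to Kaltofen's `ψ₂ = φ₂/λ` without dividing coefficients;
* over a field: `Res_{d,d}(F, F') ≠ 0 ↔ F` separable for monic `F` of degree `d`
  (`resultant_dd_ne_zero_iff_separable`), and the root-counting fact that a non-zero polynomial of
  degree `< d` does not vanish at all `d` roots of a separable split `F` (`exists_root_eval_ne_zero`).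

## References

* E. Kaltofen, J. Comput. System Sci. 50 (1995) 274–295, §5 (proof of Thm. 7). [`Kaltofen1995`]
-/

noncomputable section

open Polynomial
open scoped Matrix

namespace Literature.RingTheory.MvPolynomial.NoetherForms

/-! ### Total degree bookkeeping on `T[y][x]` -/

section TDeg

variable {T : Type*} [CommRing T]

/-- `TDeg P D`: `xⁱ yʲ` occurs in `P ∈ T[y][x]` only for `i + j ≤ D`. [folklore] -/
def TDeg (P : Polynomial (Polynomial T)) (D : ℕ) : Prop := ∀ i j, D < i + j → (P.coeff i).coeff j = 0

namespace TDeg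

/-- `0`. [folklore] -/
theorem zero (D : ℕ) : TDeg (0 : Polynomial (Polynomial T)) D := fun i j _ => by simp

/-- Monotonicity. [folklore] -/
theorem mono {P : Polynomial (Polynomial T)} {D D' : ℕ} (h : TDeg P D) (hD : D ≤ D') : TDeg P D' :=
  fun i j hij => h i j (lt_of_le_of_lt hD hij)

/-- Inner constants have total degree `0`. [folklore] -/
theorem CC (a : T) : TDeg (C (C a) : Polynomial (Polynomial T)) 0 := by
  intro i j hij
  rw [coeff_C]
  split_ifs with hi
  · subst hi
    rw [coeff_C, if_neg (by omega)]
  · simp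

/-- `x` has total degree `1`. [folklore] -/
theorem X : TDeg (Polynomial.X : Polynomial (Polynomial T)) 1 := by
  intro i j hij
  rw [coeff_X]
  split_ifs with hi
  · subst hi
    rw [coeff_one, if_neg (by omega)]
  · simp

/-- `y` has total degree `1`. [folklore] -/
theorem CX : TDeg (C Polynomial.X : Polynomial (Polynomial T)) 1 := by
  intro i j hij
  rw [coeff_C]
  split_ifs with hi
  · subst hi
    rw [coeff_X, if_neg (by omega)]
  · simp

/-- Sums. [folklore] -/
theorem add {P Q : Polynomial (Polynomial T)} {D : ℕ} (hP : TDeg P D) (hQ : TDeg Q D) : TDeg (P + Q) D :=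
  fun i j hij => by rw [coeff_add, coeff_add, hP i j hij, hQ i j hij, add_zero]

/-- Finite sums. [folklore] -/
theorem sum {ι : Type*} (s : Finset ι) (f : ι → Polynomial (Polynomial T)) (D : ℕ)
    (h : ∀ i ∈ s, TDeg (f i) D) : TDeg (∑ i ∈ s, f i) D := by
  classical
  induction s using Finset.induction_on with
  | empty => simpa using TDeg.zero (T := T) D
  | insert a s ha ih =>
    rw [Finset.sum_insert ha]
    exact (h a (Finset.mem_insert_self a s)).add (ih fun i hi => h i (Finset.mem_insert_of_mem hi))

/-- Products: total degrees add. [folklore] -/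
theorem mul {P Q : Polynomial (Polynomial T)} {D D' : ℕ} (hP : TDeg P D) (hQ : TDeg Q D') :
    TDeg (P * Q) (D + D') := by
  intro i j hij
  rw [coeff_mul, finsetSum_coeff]
  refine Finset.sum_eq_zero fun a ha => ?_
  rw [coeff_mul]
  refine Finset.sum_eq_zero fun b hb => ?_
  rw [Finset.mem_antidiagonal] at ha hb
  by_cases h1 : D < a.1 + b.1
  · rw [hP a.1 b.1 h1, zero_mul]
  · have h2 : D' < a.2 + b.2 := by omega
    rw [hQ a.2 b.2 h2, mul_zero]

/-- Powers. [folklore] -/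
theorem pow {P : Polynomial (Polynomial T)} {D : ℕ} (hP : TDeg P D) (k : ℕ) : TDeg (P ^ k) (k * D) := by
  induction k with
  | zero => simpa using TDeg.CC (T := T) 1
  | succ k ih => rw [pow_succ, Nat.succ_mul]; exact ih.mul hP

/-- Scalar multiples by inner constants. [folklore] -/
theorem CC_mul {P : Polynomial (Polynomial T)} {D : ℕ} (hP : TDeg P D) (a : T) : TDeg (C (C a) * P) D := by
  simpa using (TDeg.CC a).mul hP

/-- Consequences: `x`-degree `≤ D`. [folklore] -/
theorem coeff_eq_zero {P : Polynomial (Polynomial T)} {D : ℕ} (hP : TDeg P D) {i : ℕ} (hi : D < i) :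
    P.coeff i = 0 := by
  ext j
  rw [hP i j (by omega), coeff_zero]

/-- Consequences: `deg_x P ≤ D`. [folklore] -/
theorem natDegree_le {P : Polynomial (Polynomial T)} {D : ℕ} (hP : TDeg P D) : P.natDegree ≤ D :=
  natDegree_le_iff_coeff_eq_zero.mpr fun _ hi => hP.coeff_eq_zero hi

/-- Consequences: `deg_y (P.coeff i) ≤ D - i`. [folklore] -/
theorem natDegree_coeff_le {P : Polynomial (Polynomial T)} {D : ℕ} (hP : TDeg P D) (i : ℕ) :
    (P.coeff i).natDegree ≤ D - i :=
  natDegree_le_iff_coeff_eq_zero.mpr fun _ hj => hP i _ (by omega)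

end TDeg

end TDeg

/-! ### The specialisation homomorphism -/

section Eval

variable {n d : ℕ} {T : Type*} [CommRing T] (p : PIdx n → T) (q : CIdx n → T)

/-- `evF p q : 𝔼 n →+* T`: `c_e ↦ q e`, parameters `↦ p`. [folklore] -/
def evF (p : PIdx n → T) (q : CIdx n → T) : 𝔼 n →+* T := MvPolynomial.eval₂Hom (Int.castRingHom T) (Sum.elim p q)

/-- `evF` on a coefficient variable. [folklore] -/
@[simp] theorem evF_cvar (e : CIdx n) : evF p q (cvar n e) = q e := by simp [evF]

/-- `evF` on a parameter variable. [folklore] -/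
@[simp] theorem evF_pvar (k : Fin 3) (i : Fin n) : evF p q (pvar n k i) = p (k, i) := by simp [evF]

/-- `evF` is the `ℤ`-algebra evaluation at `Sum.elim p q`. [folklore] -/
theorem evF_eq_aeval (P : 𝔼 n) : evF p q P = MvPolynomial.aeval (Sum.elim p q) P := rfl

/-- The specialised affine substitution. [cite: Kaltofen1995, §5 (`φ₂` at `v = ν, w = ω, z = η`)] -/
def sT (p : PIdx n → T) (i : Fin n) : Polynomial (Polynomial T) :=
  if (i : ℕ) = 0 then Polynomial.X + C (C (p (0, i)))
  else C (C (p (1, i))) * Polynomial.X + C (C (p (2, i)) * Polynomial.X) + C (C (p (0, i)))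

/-- The `T[y][x]`-level map induced by `evF`. [folklore] -/
abbrev evF2 (p : PIdx n → T) (q : CIdx n → T) : Polynomial (Polynomial (𝔼 n)) →+* Polynomial (Polynomial T) :=
  mapRingHom (mapRingHom (evF p q))

/-- `sgen ↦ sT`. [folklore] -/
theorem evF2_sgen (i : Fin n) : evF2 p q (sgen n i) = sT p i := by
  unfold sgen sT
  split_ifs <;> simp [coe_mapRingHom]

/-- `sT i` has total degree `1`. [folklore] -/
theorem TDeg_sT (i : Fin n) : TDeg (sT p i) 1 := by
  unfold sT
  split_ifs
  · exact TDeg.X.add ((TDeg.CC _).mono (Nat.zero_le 1))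
  · refine ((TDeg.add ?_ ?_).add ((TDeg.CC _).mono (Nat.zero_le 1)))
    · simpa using (TDeg.CC (p (1, i))).mul TDeg.X
    · rw [map_mul]
      simpa using (TDeg.CC (p (2, i))).mul TDeg.CX

variable {p q}

/-- `fgen ↦ f` when `f` has total degree `≤ d` and `q = coeff · f`. [cite: Kaltofen1995, Thm. 7 (proof)] -/
theorem map_evF_fgen {f : MvPolynomial (Fin n) T} (hf : f.totalDegree ≤ d) (hq : ∀ e, q e = f.coeff e) :
    MvPolynomial.map (evF p q) (fgen n d) = f := by
  classical
  unfold fgen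
  rw [map_sum]
  simp only [evF_cvar, MvPolynomial.map_monomial, hq, MvPolynomial.C_mul_monomial, mul_one]
  conv_rhs => rw [f.as_sum]
  refine (Finset.sum_subset (fun e he => (mem_Sd n d).mpr ?_) fun e _ he => ?_).symm
  · exact (MvPolynomial.le_totalDegree he).trans hf
  · rw [MvPolynomial.notMem_support_iff.mp he, MvPolynomial.monomial_zero]

/-- Naturality of `MvPolynomial.aeval` into a polynomial ring under coefficient maps. [folklore] -/
theorem map_aeval_eq {R S σ : Type*} [CommRing R] [CommRing S] (g : R →+* S)
    (s : σ → Polynomial (Polynomial R)) (P : MvPolynomial σ R) :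
    (MvPolynomial.aeval s P).map (mapRingHom g) =
      MvPolynomial.aeval (fun i => (s i).map (mapRingHom g)) (MvPolynomial.map g P) := by
  have key : (mapRingHom (mapRingHom g)).comp (MvPolynomial.aeval s : MvPolynomial σ R →ₐ[R] _).toRingHom =
      (MvPolynomial.aeval (fun i => (s i).map (mapRingHom g)) : MvPolynomial σ S →ₐ[S] _).toRingHom.comp
        (MvPolynomial.map g) := by
    refine MvPolynomial.ringHom_ext (fun r => ?_) (fun i => ?_)
    · simp [Polynomial.algebraMap_apply]
    · simp [coe_mapRingHom]
  exact RingHom.congr_fun key P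

/-- `Φgen ↦ φ_p = f(sT p)`. [cite: Kaltofen1995, §5 / Thm. 7 (proof)] -/
theorem map_evF_Φgen {f : MvPolynomial (Fin n) T} (hf : f.totalDegree ≤ d) (hq : ∀ e, q e = f.coeff e) :
    evF2 p q (Φgen n d) = MvPolynomial.aeval (sT p) f := by
  rw [evF2, coe_mapRingHom, Φgen, map_aeval_eq, map_evF_fgen hf hq,
    show (fun i => (sgen n i).map (mapRingHom (evF p q))) = sT p from funext fun i => evF2_sgen p q i]

/-- `φ_p` has total degree `≤ deg f`. [folklore] -/
theorem TDeg_aeval_sT {S : Type*} [CommRing S] [Algebra S T] (f : MvPolynomial (Fin n) S) :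
    TDeg (MvPolynomial.aeval (sT p) f) f.totalDegree := by
  classical
  conv => arg 1; rw [f.as_sum, map_sum]
  refine TDeg.sum _ _ _ fun e he => ?_
  rw [MvPolynomial.aeval_monomial]
  have h1 : TDeg (e.prod fun i k => sT p i ^ k) e.degree := by
    rw [Finsupp.prod, Finsupp.degree]
    have : ∀ s : Finset (Fin n), TDeg (∏ i ∈ s, sT p i ^ e i) (∑ i ∈ s, e i) := by
      intro s
      induction s using Finset.induction_on with
      | empty => simpa using TDeg.CC (T := T) 1
      | insert a s ha ih =>
        rw [Finset.prod_insert ha, Finset.sum_insert ha]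
        exact (by simpa using (TDeg_sT p a).pow (e a) : TDeg (sT p a ^ e a) (e a)).mul ih
    exact this e.support
  have h2 := h1.CC_mul (algebraMap S T (MvPolynomial.coeff e f))
  rw [show C (C (algebraMap S T (MvPolynomial.coeff e f))) =
    algebraMap S (Polynomial (Polynomial T)) (MvPolynomial.coeff e f) from rfl] at h2
  exact h2.mono (MvPolynomial.le_totalDegree he)

/-- The specialised coefficient vector `bT (i, j) = φ_{ij} λ^{d-1-i}` of the rescaled monic
polynomial. [folklore] -/
def bT (d : ℕ) (φ : Polynomial (Polynomial T)) (ij : Idx d) : T :=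
  (φ.coeff ij.1).coeff ij.2 * (φ.coeff d).coeff 0 ^ (d - 1 - (ij.1 : ℕ))

/-- `ϕc i j ↦` the `xⁱyʲ`-coefficient of `φ_p`. [folklore] -/
theorem evF_ϕc {f : MvPolynomial (Fin n) T} (hf : f.totalDegree ≤ d) (hq : ∀ e, q e = f.coeff e) (i j : ℕ) :
    evF p q (ϕc n d i j) = ((MvPolynomial.aeval (sT p) f).coeff i).coeff j := by
  rw [ϕc, ← map_evF_Φgen hf hq, evF2, coe_mapRingHom, coeff_map, coe_mapRingHom, coeff_map]

/-- `bgen ↦ bT`. [folklore] -/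
theorem evF_comp_bgen {f : MvPolynomial (Fin n) T} (hf : f.totalDegree ≤ d) (hq : ∀ e, q e = f.coeff e) :
    (evF p q : 𝔼 n → T) ∘ bgen n d = bT d (MvPolynomial.aeval (sT p) f) := by
  ext ij
  rw [Function.comp_apply, bgen, map_mul, map_pow, lamgen, evF_ϕc hf hq, evF_ϕc hf hq, bT]

/-- `Pbar ↦ Res_{d,d}(ψ₀, ψ₀')` for `ψ₀ = genF0 d bT`. [folklore] -/
theorem evF_Pbar {f : MvPolynomial (Fin n) T} (hf : f.totalDegree ≤ d) (hq : ∀ e, q e = f.coeff e) :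
    evF p q (Pbar n d) = (genF0 d (bT d (MvPolynomial.aeval (sT p) f))).resultant
      (derivative (genF0 d (bT d (MvPolynomial.aeval (sT p) f)))) d d := by
  rw [Pbar, ← resultant_map_map, ← derivative_map, map_genF0, evF_comp_bgen hf hq]

/-- `tauR d bgen t ↦ tauR d bT t`. [folklore] -/
theorem evF_tauR_bgen {f : MvPolynomial (Fin n) T} (hf : f.totalDegree ≤ d) (hq : ∀ e, q e = f.coeff e)
    (t : TIdx d) : evF p q (tauR d (bgen n d) t) = tauR d (bT d (MvPolynomial.aeval (sT p) f)) t := by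
  rw [map_tauR, evF_comp_bgen hf hq]

end Eval

/-! ### The rescaling identity `psi d bT = λ^{d-1} φ(x/λ, y)` -/

section Rescale

variable {T : Type*} [Field T] (d : ℕ)

/-- Coefficients of `P(c x)`: `[xⁱ] P(cx) = cⁱ [xⁱ] P`. [folklore] -/
theorem coeff_comp_C_mul_X {S : Type*} [CommRing S] (P : S[X]) (c : S) (i : ℕ) :
    (P.comp (C c * X)).coeff i = c ^ i * P.coeff i := by
  rw [comp_eq_sum_left, Polynomial.sum_def, finsetSum_coeff]
  simp only [mul_pow, ← C_pow, ← mul_assoc, ← C_mul, coeff_C_mul_X_pow]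
  rw [Finset.sum_ite_eq P.support i]
  split_ifs with h
  · exact mul_comm _ _
  · rw [Polynomial.notMem_support_iff.mp h, mul_zero]

variable {d}

/-- THE RESCALING IDENTITY: if `φ ∈ T[y][x]` has total degree `≤ d` and `λ = [x^d] φ ≠ 0` then
`psi d (bT d φ) = λ^{d-1} · φ(x/λ, y)`. [cite: Kaltofen1995, §5 (`ψ₂ = φ₂ / ldcf_x(φ₂)`, here rescaled)] -/
theorem psi_bT_eq (hd : 0 < d) {φ : Polynomial (Polynomial T)} (hφ : TDeg φ d) (hlam0 : (φ.coeff d).coeff 0 ≠ 0) :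
    psi d (bT d φ) = C (C ((φ.coeff d).coeff 0 ^ (d - 1))) * φ.comp (C (C ((φ.coeff d).coeff 0)⁻¹) * X) := by
  set lam : T := (φ.coeff d).coeff 0 with hlam
  have hcd : φ.coeff d = C lam := by
    ext j
    rw [coeff_C]
    split_ifs with hj
    · rw [hj]
    · exact hφ d j (by omega)
  ext i : 1
  rw [coeff_C_mul, coeff_comp_C_mul_X, ← C_pow, ← mul_assoc, ← C_mul]
  rcases lt_trichotomy i d with hi | hid | hi
  · -- `i < d`
    rw [coeff_psi_of_lt d _ hi]
    have hdeg : (φ.coeff i).natDegree < d + 1 :=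
      Nat.lt_succ_of_le ((hφ.natDegree_coeff_le i).trans (Nat.sub_le _ _))
    conv_rhs => rw [(φ.coeff i).as_sum_range' (d + 1) hdeg, ← Fin.sum_univ_eq_sum_range, Finset.mul_sum]
    refine Finset.sum_congr rfl fun j _ => ?_
    rw [bT, ← C_mul_X_pow_eq_monomial, ← mul_assoc, ← C_mul]
    congr 2
    rw [← hlam, mul_comm]
    have hsplit : lam ^ (d - 1) = lam ^ (d - 1 - i) * lam ^ i := by
      rw [← pow_add]
      congr 1
      omega
    rw [hsplit, mul_assoc (lam ^ (d - 1 - i)) (lam ^ i), ← mul_pow, mul_inv_cancel₀ hlam0, one_pow, mul_one]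
  · -- `i = d`
    rw [hid, coeff_psi_d, hcd, ← C_mul, ← C_1]
    congr 1
    have hd1 : d - 1 + 1 = d := Nat.sub_add_cancel hd
    calc (1 : T) = (lam * lam⁻¹) ^ (d - 1) * (lam⁻¹ * lam) := by
          rw [mul_inv_cancel₀ hlam0, inv_mul_cancel₀ hlam0, one_pow, one_mul]
      _ = lam ^ (d - 1) * lam⁻¹ ^ (d - 1 + 1) * lam := by rw [pow_succ, mul_pow]; ring
      _ = lam ^ (d - 1) * lam⁻¹ ^ d * lam := by rw [hd1]
  · -- `i > d`
    rw [coeff_psi_of_gt d _ hi, hφ.coeff_eq_zero hi, mul_zero]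

/-- The algebra automorphism `x ↦ u x` of `S[x]` for a unit `u`. [folklore] -/
def compUnitEquiv {S : Type*} [CommRing S] (u : Sˣ) : S[X] ≃+* S[X] :=
  RingEquiv.ofRingHom (eval₂RingHom C (C (u : S) * X)) (eval₂RingHom C (C (↑u⁻¹ : S) * X))
    (by
      refine Polynomial.ringHom_ext (fun a => by simp) ?_
      simp only [RingHom.comp_apply, coe_eval₂RingHom, eval₂_X, eval₂_mul, eval₂_C, RingHom.id_apply]
      rw [← mul_assoc, ← C_mul, Units.inv_mul, C_1, one_mul])
    (by
      refine Polynomial.ringHom_ext (fun a => by simp) ?_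
      simp only [RingHom.comp_apply, coe_eval₂RingHom, eval₂_X, eval₂_mul, eval₂_C, RingHom.id_apply]
      rw [← mul_assoc, ← C_mul, Units.mul_inv, C_1, one_mul])

/-- `compUnitEquiv u P = P(u x)`. [folklore] -/
theorem compUnitEquiv_apply {S : Type*} [CommRing S] (u : Sˣ) (P : S[X]) :
    compUnitEquiv u P = P.comp (C (u : S) * X) := rfl

/-- IRREDUCIBILITY TRANSFER: for `λ ≠ 0`, `psi d (bT d φ)` is irreducible iff `φ` is.
[cite: Kaltofen1995, §5 (Lemma 7 is applied to `ψ₂ = φ₂/λ`)] -/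
theorem irreducible_psi_bT_iff (hd : 0 < d) {φ : Polynomial (Polynomial T)} (hφ : TDeg φ d)
    (hlam0 : (φ.coeff d).coeff 0 ≠ 0) : Irreducible (psi d (bT d φ)) ↔ Irreducible φ := by
  set lam : T := (φ.coeff d).coeff 0 with hlam
  have hu : IsUnit (C (C (lam ^ (d - 1))) : Polynomial (Polynomial T)) :=
    isUnit_C.mpr (isUnit_C.mpr (IsUnit.pow _ (Ne.isUnit hlam0)))
  have hcu : IsUnit (C lam⁻¹ : Polynomial T) := isUnit_C.mpr (Ne.isUnit (inv_ne_zero hlam0))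
  rw [psi_bT_eq hd hφ hlam0, irreducible_isUnit_mul hu, ← hlam, show C (C lam⁻¹) = C ((hcu.unit : Polynomial T)) by
    rw [IsUnit.unit_spec], ← compUnitEquiv_apply]
  exact MulEquiv.irreducible_iff (compUnitEquiv hcu.unit)

end Rescale

/-! ### Resultants `Res_{d,d}(F, F')`, separability, and simple roots -/

section Separable

variable {K : Type*} [Field K] {d : ℕ}

/-- For a monic `F` of degree `d ≥ 1` over a field, `Res_{d,d}(F, F') ≠ 0 ↔ F` is separable
(the "unramified"/squarefree condition (33) of [Kaltofen1995], `Res_x(ψ(x,0), ∂ψ(x,0)/∂x) ≠ 0`).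
[cite: Kaltofen1995, §4 (33)] -/
theorem resultant_dd_ne_zero_iff_separable {F : K[X]} (hF : F.Monic) (hd : F.natDegree = d) (hd0 : 0 < d) :
    F.resultant (derivative F) d d ≠ 0 ↔ F.Separable := by
  have hle : (derivative F).natDegree ≤ d := (natDegree_derivative_le F).trans (by omega)
  obtain ⟨e, he⟩ := Nat.exists_eq_add_of_le hle
  have hcoef : F.coeff d = 1 := by rw [← hd]; exact hF.coeff_natDegree
  have h1 : F.resultant (derivative F) d d = F.resultant (derivative F) d (derivative F).natDegree := by
    have h := resultant_add_right_deg F (derivative F) d (derivative F).natDegree e le_rfl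
    rw [← he, hcoef, one_pow, one_mul] at h
    exact h
  have h2 : F.resultant (derivative F) d (derivative F).natDegree = F.resultant (derivative F) := by rw [hd]
  rw [h1, h2, Ne, resultant_eq_zero_iff, Polynomial.Separable]
  have hF0 : F ≠ 0 := hF.ne_zero
  tauto

/-- Over an algebraically closed field: if `F` is separable of degree `d` and `R ≠ 0` has degree
`< d`, then `R(ζ) ≠ 0` for some root `ζ` of `F` (a non-zero polynomial of degree `< d` cannot vanish
at `d` distinct points). [folklore] -/
theorem exists_root_eval_ne_zero [IsAlgClosed K] {F R : K[X]} (hsep : F.Separable) (hd : F.natDegree = d)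
    (hR : R ≠ 0) (hRd : R.natDegree < d) : ∃ ζ : K, F.eval ζ = 0 ∧ R.eval ζ ≠ 0 := by
  classical
  by_contra hall
  push Not at hall
  have hF0 : F ≠ 0 := hsep.ne_zero
  -- the roots of `F` form a set of `d` elements on which `R` vanishes
  have hcard : (F.roots.toFinset).card = d := by
    rw [Multiset.toFinset_card_of_nodup (nodup_roots hsep), ← hd]
    exact ((IsAlgClosed.splits F).natDegree_eq_card_roots).symm
  have hzero : ∀ ζ ∈ F.roots.toFinset, R.eval ζ = 0 := fun ζ hζ =>
    hall ζ ((mem_roots hF0).mp (Multiset.mem_toFinset.mp hζ))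
  have := Polynomial.eq_zero_of_natDegree_lt_card_of_eval_eq_zero' R F.roots.toFinset hzero (hcard ▸ hRd)
  exact hR this

end Separable

end Literature.RingTheory.MvPolynomial.NoetherForms

/-!
# Effective Noether forms, Stage II (continued): the effective-Hilbert-irreducibility inputs
# (Kaltofen's Lemmas 2–5 and 7, existence part)

Support file for the proof of Kaltofen's Theorem 7 (`kaltofen1995_thm7`; E. Kaltofen, *Effective
Noether irreducibility forms and applications*, J. Comput. System Sci. 50 (1995) 274–295, §4–§5).
For the direction "`f` absolutely irreducible of degree `d` ⟹ some form is non-zero" the printed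
proof needs (Lemma 3) that the generic translated polynomial `ψ(x, 0, …, 0)` is squarefree, and
(Lemma 5, Thm. 5, Lemma 7) that a good bivariate substitution `f(x + ν₁, ω₂x + η₂y + ν₂, …)`
remains absolutely irreducible. This file supplies the algebra behind these existence statements:

* irreducibility is stable under injective renaming of variables (`irreducible_rename`) and under
  the affine automorphisms used by Kaltofen ("the substitution … produces a factorization of `f`",
  proofs of Lemmas 2 and 5);
* factors of weighted homogeneous polynomials are weighted homogeneous (`ℤ`-weights, integral
  domain) (`IsWeightedHomogeneous.of_mul_left`) — our replacement for the `y ↦ 1/y` substitution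
  in the proof of Lemma 5;
* Claim A: irreducibility of a bivariate image of `x`-degree `d` forces irreducibility of `f`
  (the trivial direction of Lemma 7);
* LEMMA 3 (`separable_map_aeval_s0`): for `f` irreducible over a perfect field some partial
  derivative is non-zero (`exists_pderiv_ne_zero_of_irreducible`, via `p`-th powers in
  characteristic `p`), whence the univariate translate `f(x + ν₁, ω₂x + ν₂, …)` is separable for
  generic `(ν, ω)` (Kaltofen: "`ψ(x, 0, …, 0)` is squarefree", proof of Lemma 3 by the chain rule);
* LEMMA 4, existence part (`exists_point_separable`): over an algebraically closed field there is a
  point `(ν, ω, η)` with `λ = ldcf ≠ 0` and `ψ₀ = genF0 d (bT d φ_p)` separable (Kaltofen's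
  polynomial `Ξ = λ · Res`, here `lamA * resA`, is non-zero).

The irreducibility of the generic bivariate image (Lemma 5 / Thm. 5 / Lemma 7) and Claim B are in
the sequel file.

## References

* E. Kaltofen, J. Comput. System Sci. 50 (1995) 274–295, §4 Lemmas 2–5, Thm. 5; §5 Lemma 7.
  [`Kaltofen1995`]
-/

noncomputable section

open Polynomial
open scoped Matrix

namespace Literature.RingTheory.MvPolynomial.NoetherForms

open _root_.MvPolynomial (IsWeightedHomogeneous rename)

/-! ### Irreducibility under injective renaming -/

section Rename

variable {σ τ R : Type*} [CommRing R] {ι : σ → τ}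

/-- Killing the variables outside the range of an injective renaming is a left inverse. [folklore] -/
theorem aeval_extend_rename (hι : Function.Injective ι) (f : MvPolynomial σ R) :
    MvPolynomial.aeval (Function.extend ι MvPolynomial.X (0 : τ → MvPolynomial σ R)) (rename ι f) = f := by
  rw [MvPolynomial.aeval_rename, Function.extend_comp hι, MvPolynomial.aeval_X_left, AlgHom.id_apply]

/-- A factor of a renamed polynomial only involves renamed variables. [folklore] -/
theorem vars_subset_range_of_mul_eq_rename [IsDomain R] [DecidableEq τ] {f : MvPolynomial σ R}
    {a b : MvPolynomial τ R} (hf : rename ι f ≠ 0) (hab : a * b = rename ι f) :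
    (↑a.vars : Set τ) ⊆ Set.range ι := by
  intro t ht
  have ha : a ≠ 0 := fun h => hf (by rw [← hab, h, zero_mul])
  have hb : b ≠ 0 := fun h => hf (by rw [← hab, h, mul_zero])
  have h1 : (a * b).degreeOf t ≠ 0 := by
    rw [MvPolynomial.degreeOf_mul_eq ha hb]
    have := MvPolynomial.mem_vars_iff_degreeOf_ne_zero.mp (Finset.mem_coe.mp ht)
    omega
  have h2 : t ∈ (rename ι f).vars := by rw [← hab]; exact MvPolynomial.mem_vars_iff_degreeOf_ne_zero.mpr h1
  have h3 := MvPolynomial.vars_rename ι f h2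
  rw [Finset.mem_image] at h3
  obtain ⟨s, -, rfl⟩ := h3
  exact ⟨s, rfl⟩

/-- **Injective renaming preserves irreducibility** (over an integral domain). [folklore] -/
theorem irreducible_rename [IsDomain R] (hι : Function.Injective ι) {f : MvPolynomial σ R} (hf : Irreducible f) :
    Irreducible (rename ι f) := by
  classical
  refine ⟨fun hu => hf.not_isUnit ?_, fun a b hab => ?_⟩
  · have := hu.map (MvPolynomial.aeval (Function.extend ι MvPolynomial.X (0 : τ → MvPolynomial σ R)))
    rwa [aeval_extend_rename hι] at this
  · have hf0 : rename ι f ≠ 0 := fun h => hf.ne_zero (MvPolynomial.rename_injective ι hι (by rw [h, map_zero]))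
    obtain ⟨a', rfl⟩ := MvPolynomial.exists_rename_eq_of_vars_subset_range a ι hι
      (vars_subset_range_of_mul_eq_rename hf0 hab.symm)
    obtain ⟨b', rfl⟩ := MvPolynomial.exists_rename_eq_of_vars_subset_range b ι hι
      (vars_subset_range_of_mul_eq_rename hf0 (by rw [mul_comm]; exact hab.symm))
    rw [← map_mul] at hab
    have hab' : f = a' * b' := MvPolynomial.rename_injective ι hι hab
    rcases hf.isUnit_or_isUnit hab' with h | h
    · exact Or.inl (h.map _)
    · exact Or.inr (h.map _)

end Rename

/-! ### Factors of weighted homogeneous polynomials (`ℤ`-weights) -/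

section GradedFactor

variable {σ R : Type*} [CommRing R] (w : σ → ℤ)

/-- The weight for negated weights is the negated weight. [folklore] -/
theorem weight_neg (m : σ →₀ ℕ) : Finsupp.weight (fun i => -w i) m = -Finsupp.weight w m := by
  rw [Finsupp.weight_apply, Finsupp.weight_apply, Finsupp.sum, Finsupp.sum, ← Finset.sum_neg_distrib]
  simp

variable {w}

/-- Homogeneity for negated weights (a deliberate dot-notation extension of Mathlib's
`MvPolynomial.IsWeightedHomogeneous`). [folklore] -/
theorem _root_.MvPolynomial.IsWeightedHomogeneous.neg_weights {φ : MvPolynomial σ R} {n : ℤ}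
    (h : IsWeightedHomogeneous w φ n) :
    IsWeightedHomogeneous (fun i => -w i) φ (-n) := fun m hm => by
  rw [weight_neg, h hm]

/-- The key inequality: if `φ ψ` is weighted homogeneous of weight `n` (over a domain), then
`n ≤ weight m₁ + weight m₂` for all `m₁ ∈ supp φ`, `m₂ ∈ supp ψ` (the lowest components multiply
to a non-zero component). [folklore] -/
theorem le_weight_add_weight_of_mul [IsDomain R] {φ ψ : MvPolynomial σ R} {n : ℤ}
    (h : IsWeightedHomogeneous w (φ * ψ) n) {m₁ m₂ : σ →₀ ℕ} (hm₁ : m₁ ∈ φ.support)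
    (hm₂ : m₂ ∈ ψ.support) : n ≤ Finsupp.weight w m₁ + Finsupp.weight w m₂ := by
  classical
  -- the minimal weights
  set Wφ : Finset ℤ := φ.support.image (Finsupp.weight w) with hWφ
  set Wψ : Finset ℤ := ψ.support.image (Finsupp.weight w) with hWψ
  have hne₁ : Wφ.Nonempty := ⟨_, Finset.mem_image_of_mem _ hm₁⟩
  have hne₂ : Wψ.Nonempty := ⟨_, Finset.mem_image_of_mem _ hm₂⟩
  set a := Wφ.min' hne₁ with ha
  set b := Wψ.min' hne₂ with hb
  have ha_le : ∀ m ∈ φ.support, a ≤ Finsupp.weight w m := fun m hm =>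
    Finset.min'_le _ _ (Finset.mem_image_of_mem _ hm)
  have hb_le : ∀ m ∈ ψ.support, b ≤ Finsupp.weight w m := fun m hm =>
    Finset.min'_le _ _ (Finset.mem_image_of_mem _ hm)
  -- the lowest components
  set φ₁ := MvPolynomial.weightedHomogeneousComponent w a φ with hφ₁
  set ψ₁ := MvPolynomial.weightedHomogeneousComponent w b ψ with hψ₁
  have hφ₁ne : φ₁ ≠ 0 := by
    obtain ⟨m, hm, hma⟩ := Finset.mem_image.mp (Finset.min'_mem Wφ hne₁)
    intro h0
    have := congrArg (MvPolynomial.coeff m) h0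
    rw [hφ₁, MvPolynomial.coeff_weightedHomogeneousComponent, if_pos hma, MvPolynomial.coeff_zero] at this
    exact (MvPolynomial.mem_support_iff.mp hm) this
  have hψ₁ne : ψ₁ ≠ 0 := by
    obtain ⟨m, hm, hmb⟩ := Finset.mem_image.mp (Finset.min'_mem Wψ hne₂)
    intro h0
    have := congrArg (MvPolynomial.coeff m) h0
    rw [hψ₁, MvPolynomial.coeff_weightedHomogeneousComponent, if_pos hmb, MvPolynomial.coeff_zero] at this
    exact (MvPolynomial.mem_support_iff.mp hm) this
  obtain ⟨m, hm⟩ := MvPolynomial.ne_zero_iff.mp (mul_ne_zero hφ₁ne hψ₁ne)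
  -- `coeff m (φ ψ) = coeff m (φ₁ ψ₁)`
  have hcoeff : MvPolynomial.coeff m (φ * ψ) = MvPolynomial.coeff m (φ₁ * ψ₁) := by
    rw [MvPolynomial.coeff_mul, MvPolynomial.coeff_mul]
    refine Finset.sum_congr rfl fun x hx => ?_
    rw [hφ₁, hψ₁, MvPolynomial.coeff_weightedHomogeneousComponent,
      MvPolynomial.coeff_weightedHomogeneousComponent]
    have hwm : Finsupp.weight w m = a + b :=
      ((MvPolynomial.weightedHomogeneousComponent_isWeightedHomogeneous a φ).mul
        (MvPolynomial.weightedHomogeneousComponent_isWeightedHomogeneous b ψ)) hm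
    have hxm : x.1 + x.2 = m := Finset.mem_antidiagonal.mp hx
    have hwsum : Finsupp.weight w x.1 + Finsupp.weight w x.2 = a + b := by
      rw [← map_add, hxm, hwm]
    by_cases h1 : MvPolynomial.coeff x.1 φ = 0
    · rw [h1, zero_mul]; split_ifs <;> simp
    by_cases h2 : MvPolynomial.coeff x.2 ψ = 0
    · rw [h2, mul_zero]; split_ifs <;> simp
    have hx1 := ha_le x.1 (MvPolynomial.mem_support_iff.mpr h1)
    have hx2 := hb_le x.2 (MvPolynomial.mem_support_iff.mpr h2)
    rw [if_pos (by omega), if_pos (by omega)]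
  have hm' : MvPolynomial.coeff m (φ * ψ) ≠ 0 := by rwa [hcoeff]
  have hn : Finsupp.weight w m = n := h hm'
  have hwm : Finsupp.weight w m = a + b :=
    ((MvPolynomial.weightedHomogeneousComponent_isWeightedHomogeneous a φ).mul
      (MvPolynomial.weightedHomogeneousComponent_isWeightedHomogeneous b ψ)) hm
  have := ha_le m₁ hm₁
  have := hb_le m₂ hm₂
  omega

/-- **Factors of weighted homogeneous polynomials are weighted homogeneous** (`ℤ`-weights,
integral domain; a deliberate dot-notation extension of Mathlib's `MvPolynomial.IsWeightedHomogeneous`). [folklore] -/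
theorem _root_.MvPolynomial.IsWeightedHomogeneous.exists_of_mul_left [IsDomain R] {φ ψ : MvPolynomial σ R} {n : ℤ}
    (h : IsWeightedHomogeneous w (φ * ψ) n) (hψ : ψ ≠ 0) : ∃ a, IsWeightedHomogeneous w φ a := by
  obtain ⟨m₂, hm₂⟩ := MvPolynomial.ne_zero_iff.mp hψ
  have hm₂' : m₂ ∈ ψ.support := MvPolynomial.mem_support_iff.mpr hm₂
  refine ⟨n - Finsupp.weight w m₂, fun m₁ hm₁ => ?_⟩
  have hm₁' : m₁ ∈ φ.support := MvPolynomial.mem_support_iff.mpr hm₁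
  have h1 := le_weight_add_weight_of_mul h hm₁' hm₂'
  have h2 := le_weight_add_weight_of_mul h.neg_weights hm₁' hm₂'
  rw [weight_neg, weight_neg] at h2
  omega

/-- The weight of a factor: if `φ ψ` has weight `n`, `φ` weight `a` (`φ ψ ≠ 0`), then `ψ` has weight
`n - a` (dot-notation extension of Mathlib's `MvPolynomial.IsWeightedHomogeneous`). [folklore] -/
theorem _root_.MvPolynomial.IsWeightedHomogeneous.of_mul_right_weight [IsDomain R] {φ ψ : MvPolynomial σ R} {n a : ℤ}
    (h : IsWeightedHomogeneous w (φ * ψ) n) (hφ : IsWeightedHomogeneous w φ a) (hφ0 : φ ≠ 0) :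
    IsWeightedHomogeneous w ψ (n - a) := by
  obtain ⟨m₁, hm₁⟩ := MvPolynomial.ne_zero_iff.mp hφ0
  have hm₁' : m₁ ∈ φ.support := MvPolynomial.mem_support_iff.mpr hm₁
  have ha : Finsupp.weight w m₁ = a := hφ hm₁
  intro m₂ hm₂
  have hm₂' : m₂ ∈ ψ.support := MvPolynomial.mem_support_iff.mpr hm₂
  have h1 := le_weight_add_weight_of_mul h hm₁' hm₂'
  have h2 := le_weight_add_weight_of_mul h.neg_weights hm₁' hm₂'
  rw [weight_neg, weight_neg] at h2
  omega

end GradedFactor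

/-! ### Claim A: an irreducible bivariate image of full `x`-degree forces `f` irreducible -/

section ClaimA

variable {F : Type*} [Field F] {n d : ℕ}

/-- **Claim A** (the trivial direction of Kaltofen's Lemma 7: "if `f` factors over `K̄`, so does
`φ₂`"): if `f` has total degree `d`, the coefficient of `x^d` in `φ_p = f(sT p)` is non-zero and
`φ_p` is irreducible in `F[y][x]`, then `f` is irreducible. [cite: Kaltofen1995, Lemma 7 (proof, first sentence)] -/
theorem irreducible_of_irreducible_aeval_sT {f : MvPolynomial (Fin n) F} (hf : f.totalDegree = d)
    (p : PIdx n → F) (hlam : ((MvPolynomial.aeval (sT p) f).coeff d).coeff 0 ≠ 0)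
    (hirr : Irreducible (MvPolynomial.aeval (sT p) f)) : Irreducible f := by
  set Φ := (MvPolynomial.aeval (sT p) : MvPolynomial (Fin n) F →ₐ[F] Polynomial (Polynomial F)) with hΦ
  have hΦdeg : ∀ g : MvPolynomial (Fin n) F, (Φ g).natDegree ≤ g.totalDegree := fun g =>
    (TDeg_aeval_sT (p := p) g).natDegree_le
  have hfd : (Φ f).natDegree = d := by
    refine le_antisymm (hf ▸ hΦdeg f) (le_natDegree_of_ne_zero fun h => hlam ?_)
    rw [hΦ] at h
    rw [h, coeff_zero]
  refine ⟨fun hu => hirr.not_isUnit (hu.map Φ), fun a b hab => ?_⟩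
  have hab' : Φ f = Φ a * Φ b := by rw [hab, map_mul]
  have hf0 : f ≠ 0 := fun h => hirr.ne_zero (by rw [h, map_zero])
  have ha0 : a ≠ 0 := fun h => hf0 (by rw [hab, h, zero_mul])
  have hb0 : b ≠ 0 := fun h => hf0 (by rw [hab, h, mul_zero])
  have hΦa0 : Φ a ≠ 0 := fun h => hirr.ne_zero (by rw [hab', h, zero_mul])
  have hΦb0 : Φ b ≠ 0 := fun h => hirr.ne_zero (by rw [hab', h, mul_zero])
  have htot : a.totalDegree + b.totalDegree = d := by
    rw [← hf, hab, MvPolynomial.totalDegree_mul_of_isDomain ha0 hb0]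
  have hdegsum : (Φ a).natDegree + (Φ b).natDegree = d := by
    rw [← natDegree_mul hΦa0 hΦb0, ← hab', hfd]
  rcases hirr.isUnit_or_isUnit hab' with h | h
  · -- `Φ a` is a unit, hence of `x`-degree `0`; then `deg b = d` and `a` is a constant
    left
    have h1 : (Φ a).natDegree = 0 := natDegree_eq_zero_of_isUnit h
    have h2 : a.totalDegree = 0 := by have := hΦdeg b; omega
    rw [MvPolynomial.totalDegree_eq_zero_iff_eq_C] at h2
    rw [h2]
    refine (isUnit_iff_ne_zero.mpr fun h0 => ha0 ?_).map MvPolynomial.C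
    rw [h2, h0, map_zero]
  · right
    have h1 : (Φ b).natDegree = 0 := natDegree_eq_zero_of_isUnit h
    have h2 : b.totalDegree = 0 := by have := hΦdeg a; omega
    rw [MvPolynomial.totalDegree_eq_zero_iff_eq_C] at h2
    rw [h2]
    refine (isUnit_iff_ne_zero.mpr fun h0 => hb0 ?_).map MvPolynomial.C
    rw [h2, h0, map_zero]

end ClaimA

/-! ### Partial derivatives: the chain rule along a univariate substitution, and `p`-th powers -/

section PDeriv

variable {F : Type*} [Field F] {σ : Type*} [DecidableEq σ]

/-- CHAIN RULE: `d/dx f(s(x)) = Σᵢ (∂ᵢf)(s(x)) · sᵢ'(x)` for `s : σ → B[x]`, `B` an `F`-algebra.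
[folklore] -/
theorem derivative_aeval [Fintype σ] {B : Type*} [CommRing B] [Algebra F B] (s : σ → Polynomial B)
    (f : MvPolynomial σ F) :
    derivative (MvPolynomial.aeval s f) =
      ∑ i, MvPolynomial.aeval s (MvPolynomial.pderiv i f) * derivative (s i) := by
  induction f using MvPolynomial.induction_on with
  | C a => simp [Polynomial.algebraMap_apply]
  | add p q hp hq => simp only [map_add, hp, hq, add_mul, Finset.sum_add_distrib]
  | mul_X p i hp =>
    have key : ∀ j, MvPolynomial.aeval s (MvPolynomial.pderiv j (p * MvPolynomial.X i)) * derivative (s j) =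
        MvPolynomial.aeval s (MvPolynomial.pderiv j p) * derivative (s j) * s i +
          (if j = i then MvPolynomial.aeval s p * derivative (s i) else 0) := by
      intro j
      rw [MvPolynomial.pderiv_mul]
      by_cases hji : j = i
      · subst hji
        rw [MvPolynomial.pderiv_X_self, if_pos rfl, map_add, map_mul, map_mul, MvPolynomial.aeval_X, map_one]
        ring
      · rw [MvPolynomial.pderiv_X_of_ne (Ne.symm hji), if_neg hji, mul_zero, add_zero, map_mul,
          MvPolynomial.aeval_X]
        ring
    rw [map_mul, MvPolynomial.aeval_X, derivative_mul, hp, Finset.sum_congr rfl (fun j _ => key j),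
      Finset.sum_add_distrib, Finset.sum_ite_eq' Finset.univ i, if_pos (Finset.mem_univ i), Finset.sum_mul]

/-- In characteristic `p`, if `∂ᵢ f = 0` for all `i` then every exponent occurring in `f` is a
multiple of `p`. [folklore] -/
theorem dvd_of_pderiv_eq_zero (p : ℕ) [CharP F p] {f : MvPolynomial σ F} (h : ∀ i, MvPolynomial.pderiv i f = 0)
    {m : σ →₀ ℕ} (hm : m ∈ f.support) (i : σ) : p ∣ m i := by
  by_cases hi : m i = 0
  · rw [hi]; exact dvd_zero p
  · obtain ⟨k, hk⟩ := Nat.exists_eq_succ_of_ne_zero hi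
    have hc := MvPolynomial.coeff_pderiv (i := i) f (m - Finsupp.single i 1)
    set m' : σ →₀ ℕ := m - Finsupp.single i 1 with hm'def
    have hm' : m' + Finsupp.single i 1 = m := by
      ext j
      by_cases hj : j = i
      · subst hj; simp [hm'def]; omega
      · simp [hm'def, hj]
    rw [h i, MvPolynomial.coeff_zero, hm'] at hc
    have hne : MvPolynomial.coeff m f ≠ 0 := MvPolynomial.mem_support_iff.mp hm
    have hcast : ((m' i : ℕ) : F) + 1 = 0 := by
      rcases mul_eq_zero.mp hc.symm with h0 | h0
      · exact (hne h0).elim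
      · exact h0
    have : ((m i : ℕ) : F) = 0 := by
      have e : m i = m' i + 1 := by simp [hm'def]; omega
      rw [e]; push_cast; exact hcast
    exact (CharP.cast_eq_zero_iff F p _).mp this

/-- In characteristic `p` over a perfect field, a polynomial all of whose partial derivatives vanish
is a `p`-th power. [folklore] -/
theorem exists_eq_pow_of_pderiv_eq_zero (p : ℕ) [Fact p.Prime] [CharP F p] [PerfectRing F p]
    {f : MvPolynomial σ F} (h : ∀ i, MvPolynomial.pderiv i f = 0) : ∃ g : MvPolynomial σ F, f = g ^ p := by
  classical
  have hp : 0 < p := (Fact.out : p.Prime).pos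
  -- divide the exponents by `p` and take `p`-th roots of the coefficients
  let mdiv : (σ →₀ ℕ) → (σ →₀ ℕ) := fun m => Finsupp.mapRange (fun k => k / p) (by simp) m
  refine ⟨∑ m ∈ f.support, MvPolynomial.monomial (mdiv m) ((frobeniusEquiv F p).symm (f.coeff m)), ?_⟩
  rw [← frobenius_def, map_sum]
  conv_lhs => rw [f.as_sum]
  refine Finset.sum_congr rfl fun m hm => ?_
  have hsm : p • mdiv m = m := by
    ext i
    simp only [mdiv, Finsupp.coe_smul, Pi.smul_apply, Finsupp.mapRange_apply, smul_eq_mul]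
    exact Nat.mul_div_cancel' (dvd_of_pderiv_eq_zero p h hm i)
  rw [frobenius_def, MvPolynomial.monomial_pow, frobeniusEquiv_symm_pow_p, hsm]

/-- Hence an irreducible polynomial over a perfect field of characteristic `p` has some non-zero
partial derivative. [folklore] -/
theorem exists_pderiv_ne_zero_of_irreducible (p : ℕ) [Fact p.Prime] [CharP F p] [PerfectRing F p]
    {f : MvPolynomial σ F} (hf : Irreducible f) : ∃ i, MvPolynomial.pderiv i f ≠ 0 := by
  by_contra hall
  push Not at hall
  obtain ⟨g, rfl⟩ := exists_eq_pow_of_pderiv_eq_zero p hall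
  exact not_irreducible_pow (Fact.out : p.Prime).one_lt.ne' hf

/-- In characteristic `0`, a polynomial all of whose partial derivatives vanish is constant. [folklore] -/
theorem eq_C_of_pderiv_eq_zero [CharZero F] {f : MvPolynomial σ F} (h : ∀ i, MvPolynomial.pderiv i f = 0) :
    f = MvPolynomial.C (f.coeff 0) := by
  classical
  ext m
  rw [MvPolynomial.coeff_C]
  split_ifs with hm
  · rw [← hm]
  · -- some exponent of `m` is positive; use `∂ᵢ f = 0` there
    obtain ⟨i, hi⟩ : ∃ i, m i ≠ 0 := by
      by_contra hall
      push Not at hall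
      exact hm (Finsupp.ext fun i => by simpa using hall i).symm
    by_contra hne
    obtain ⟨k, hk⟩ := Nat.exists_eq_succ_of_ne_zero hi
    set m' : σ →₀ ℕ := m - Finsupp.single i 1 with hm'def
    have hm' : m' + Finsupp.single i 1 = m := by
      ext j
      by_cases hj : j = i
      · subst hj; simp [hm'def]; omega
      · simp [hm'def, hj]
    have hc := MvPolynomial.coeff_pderiv (i := i) f m'
    rw [h i, MvPolynomial.coeff_zero, hm'] at hc
    rcases mul_eq_zero.mp hc.symm with h0 | h0
    · exact hne h0
    · have : ((m' i + 1 : ℕ) : F) = 0 := by push_cast; exact h0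
      exact Nat.succ_ne_zero _ (Nat.cast_eq_zero.mp this)

end PDeriv

/-! ### The leading `x`-coefficient of an affine-linear substitution -/

section TopCoeff

variable {F : Type*} [Field F] {σ : Type*} {T : Type*} [CommRing T] [Algebra F T]

/-- A product of affine-linear polynomials `Π_{i ∈ S} (aᵢ x + bᵢ)^{eᵢ}` has degree `≤ Σ eᵢ` and
`x^{Σ eᵢ}`-coefficient `Π aᵢ^{eᵢ}`. [folklore] -/
theorem coeff_finsetProd_affine_pow (a b : σ → T) (e : σ → ℕ) (S : Finset σ) :
    (∏ i ∈ S, (C (a i) * X + C (b i)) ^ e i).natDegree ≤ ∑ i ∈ S, e i ∧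
      (∏ i ∈ S, (C (a i) * X + C (b i)) ^ e i).coeff (∑ i ∈ S, e i) = ∏ i ∈ S, a i ^ e i := by
  classical
  induction S using Finset.induction_on with
  | empty => simp
  | insert j s hj ih =>
    obtain ⟨ih1, ih2⟩ := ih
    rw [Finset.prod_insert hj, Finset.prod_insert hj, Finset.sum_insert hj]
    have h0 : (C (a j) * X + C (b j)).natDegree ≤ 1 :=
      (natDegree_add_le _ _).trans (max_le ((natDegree_C_mul_le _ _).trans natDegree_X_le) (by simp))
    have h1 : ((C (a j) * X + C (b j)) ^ e j).natDegree ≤ e j := by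
      refine natDegree_pow_le.trans ?_
      calc e j * (C (a j) * X + C (b j)).natDegree ≤ e j * 1 := Nat.mul_le_mul_left _ h0
        _ = e j := mul_one _
    have h2 : ((C (a j) * X + C (b j)) ^ e j).coeff (e j) = a j ^ e j := by
      have := coeff_pow_of_natDegree_le (p := C (a j) * X + C (b j)) (n := 1) h0 (m := e j)
      rw [mul_one] at this
      rw [this]
      simp
    refine ⟨natDegree_mul_le.trans (add_le_add h1 ih1), ?_⟩
    rw [coeff_mul_add_eq_of_natDegree_le h1 ih1, h2, ih2]

/-- The same for `e : σ →₀ ℕ`: degree `≤ |e|`, top coefficient `Π aᵢ^{eᵢ}`. [folklore] -/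
theorem coeff_prod_affine_pow (a b : σ → T) (e : σ →₀ ℕ) :
    (e.prod fun i k => (C (a i) * X + C (b i)) ^ k).natDegree ≤ e.degree ∧
      (e.prod fun i k => (C (a i) * X + C (b i)) ^ k).coeff e.degree = e.prod fun i k => a i ^ k := by
  rw [Finsupp.prod, Finsupp.prod, Finsupp.degree_apply]
  exact coeff_finsetProd_affine_pow a b e e.support

/-- THE TOP COEFFICIENT: for affine-linear `sᵢ = aᵢ x + bᵢ` and `f` of total degree `≤ d`,
`[x^d] f(s) = f_d(a)`, where `f_d` is the degree-`d` homogeneous component. [cite: Kaltofen1995, §4 (30) (`ldcf_x(φ) = Σ_{|e|=d} q_e w₂^{e₂}⋯wₙ^{eₙ}`)] -/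
theorem coeff_aeval_affine {s : σ → Polynomial T} {a b : σ → T} (hs : ∀ i, s i = C (a i) * X + C (b i))
    {f : MvPolynomial σ F} {d : ℕ} (hf : f.totalDegree ≤ d) :
    (MvPolynomial.aeval s f).coeff d = MvPolynomial.aeval a (MvPolynomial.homogeneousComponent d f) := by
  classical
  have hs' : s = fun i => C (a i) * X + C (b i) := funext hs
  subst hs'
  conv_lhs => rw [f.as_sum, map_sum]
  rw [finsetSum_coeff]
  conv_rhs => rw [f.as_sum, map_sum, map_sum]
  refine Finset.sum_congr rfl fun e he => ?_
  have hed : e.degree ≤ d := (MvPolynomial.le_totalDegree he).trans hf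
  obtain ⟨hdeg, hcoeff⟩ := coeff_prod_affine_pow a b e
  rw [MvPolynomial.aeval_monomial, Polynomial.algebraMap_apply, coeff_C_mul,
    MvPolynomial.homogeneousComponent_of_mem (MvPolynomial.isHomogeneous_monomial _ rfl)]
  by_cases h : e.degree = d
  · rw [if_pos h.symm, MvPolynomial.aeval_monomial, ← h, hcoeff]
  · rw [if_neg (Ne.symm h), map_zero, coeff_eq_zero_of_natDegree_lt (lt_of_le_of_lt hdeg (by omega)),
      mul_zero]

/-- Homogeneous polynomials scale: `f(t x) = t^n f(x)`. [folklore] -/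
theorem eval_smul_of_isHomogeneous {f : MvPolynomial σ F} {n : ℕ} (hf : f.IsHomogeneous n) (t : F)
    (x : σ → F) : MvPolynomial.eval (t • x) f = t ^ n * MvPolynomial.eval x f := by
  classical
  conv_lhs => rw [f.as_sum, map_sum]
  conv_rhs => rw [f.as_sum, map_sum, Finset.mul_sum]
  refine Finset.sum_congr rfl fun e he => ?_
  rw [MvPolynomial.eval_monomial, MvPolynomial.eval_monomial]
  have hdeg : n = ∑ i ∈ e.support, e i := hf.degree_eq_sum_deg_support he
  simp only [Pi.smul_apply, smul_eq_mul, mul_pow]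
  rw [Finsupp.prod_mul, hdeg, ← Finset.prod_pow_eq_pow_sum, Finsupp.prod, Finsupp.prod]
  ring

/-- DEHOMOGENISATION: over an infinite field, a homogeneous `g` vanishing at all points with first
coordinate `1` is zero (`g(t, t x') = t^n g(1, x')`, so `X₀ g ≡ 0`). Applied to the top-degree part
`f_d`, this is why `λ = ldcf_x(φ)` is a non-zero polynomial ("Since `f` has total degree `d`, `l` is a
non-zero element in `K[w₂, …, wₙ]`", [Kaltofen1995] §4). [cite: Kaltofen1995, §4 (after (30))] -/
theorem eq_zero_of_isHomogeneous_of_eval_eq_zero [Infinite F] {m : ℕ} {g : MvPolynomial (Fin (m + 1)) F}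
    {n : ℕ} (hg : g.IsHomogeneous n) (h : ∀ x : Fin (m + 1) → F, x 0 = 1 → MvPolynomial.eval x g = 0) :
    g = 0 := by
  have key : MvPolynomial.X 0 * g = 0 := by
    refine MvPolynomial.funext fun x => ?_
    rw [map_mul, MvPolynomial.eval_X, map_zero]
    by_cases hx : x 0 = 0
    · rw [hx, zero_mul]
    · have hscale : x = x 0 • ((x 0)⁻¹ • x) := by
        rw [smul_smul, mul_inv_cancel₀ hx, one_smul]
      have h1 : MvPolynomial.eval ((x 0)⁻¹ • x) g = 0 := h _ (by simp [inv_mul_cancel₀ hx])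
      conv_lhs => rw [hscale]
      rw [eval_smul_of_isHomogeneous hg, h1, mul_zero, mul_zero]
  rcases mul_eq_zero.mp key with h0 | h0
  · exact ((MvPolynomial.X_ne_zero (0 : Fin (m + 1))) h0).elim
  · exact h0

end TopCoeff

/-! ### Separability under rescaling -/

section SepScale

variable {K : Type*} [Field K]

/-- Rescaling `x ↦ u x` and multiplying by a non-zero constant preserve separability. [folklore] -/
theorem separable_C_mul_comp_C_mul_X {P : K[X]} (hP : P.Separable) {c u : K} (hc : c ≠ 0) (hu : u ≠ 0) :
    (C c * P.comp (C u * X)).Separable := by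
  set e : K[X] →+* K[X] := (compUnitEquiv (Units.mk0 u hu)).toRingHom with he
  have heP : ∀ Q : K[X], e Q = Q.comp (C u * X) := fun Q => rfl
  -- separability of the rescaled polynomial
  have h1 : (P.comp (C u * X)).Separable := by
    obtain ⟨a, b, hab⟩ := hP
    have hab' := congrArg e hab
    rw [map_add, map_mul, map_mul, map_one, heP, heP, heP, heP] at hab'
    have hder : derivative (P.comp (C u * X)) = C u * (derivative P).comp (C u * X) := by
      rw [derivative_comp, derivative_mul, derivative_C, zero_mul, derivative_X, zero_add, mul_one]
    refine ⟨a.comp (C u * X), b.comp (C u * X) * C u⁻¹, ?_⟩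
    rw [hder, mul_assoc, ← mul_assoc (C u⁻¹), ← C_mul, inv_mul_cancel₀ hu, C_1, one_mul]
    exact hab'
  -- multiplication by a unit
  obtain ⟨a, b, hab⟩ := h1
  refine ⟨a * C c⁻¹, b * C c⁻¹, ?_⟩
  rw [derivative_mul, derivative_C, zero_mul, zero_add]
  calc a * C c⁻¹ * (C c * P.comp (C u * X)) + b * C c⁻¹ * (C c * derivative (P.comp (C u * X)))
        = (a * P.comp (C u * X) + b * derivative (P.comp (C u * X))) * (C c⁻¹ * C c) := by ring
    _ = 1 := by rw [hab, ← C_mul, inv_mul_cancel₀ hc, C_1, one_mul]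

end SepScale

/-! ### Lemma 3 (Kaltofen): the generic translate `f(x + v₀, w₁ x + v₁, …)` is separable in `x` -/

section Lemma3

variable {F : Type*} [Field F] {n : ℕ}

/-- The univariate substitution `X₀ ↦ x + v₀`, `Xᵢ ↦ wᵢ x + vᵢ` (`= sT` at `y = 0`). [cite: Kaltofen1995, §4 (`ψ(x, 0, …, 0)`)] -/
def s0 {T : Type*} [CommRing T] (p : PIdx n → T) (i : Fin n) : Polynomial T :=
  if (i : ℕ) = 0 then Polynomial.X + C (p (0, i)) else C (p (1, i)) * Polynomial.X + C (p (0, i))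

/-- `s0` is `sT` at `y = 0`. [folklore] -/
theorem map_evalRingHom_zero_sT {T : Type*} [CommRing T] (p : PIdx n → T) (i : Fin n) :
    (sT p i).map (evalRingHom 0) = s0 p i := by
  unfold sT s0
  split_ifs <;> simp

/-- The same substitution inside `F[x, v, w, z]` (`x = X none`). [folklore] -/
def θ3 (i : Fin n) : MvPolynomial (Option (PIdx n)) F :=
  if (i : ℕ) = 0 then MvPolynomial.X none + MvPolynomial.X (some (0, i))
  else MvPolynomial.X (some (1, i)) * MvPolynomial.X none + MvPolynomial.X (some (0, i))

/-- The affine automorphism `v₀ ↦ x + v₀`, `vᵢ ↦ wᵢ x + vᵢ` of `F[x, v, w, z]` (forward map on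
variables). [cite: Kaltofen1995, Lemma 2 (proof: the substitution and its inverse)] -/
def θα : Option (PIdx n) → MvPolynomial (Option (PIdx n)) F
  | none => MvPolynomial.X none
  | some (k, i) => if k = 0 then θ3 i else MvPolynomial.X (some (k, i))

/-- The inverse substitution `v₀ ↦ v₀ - x`, `vᵢ ↦ vᵢ - wᵢ x`. [cite: Kaltofen1995, Lemma 2 (proof)] -/
def θα' : Option (PIdx n) → MvPolynomial (Option (PIdx n)) F
  | none => MvPolynomial.X none
  | some (k, i) => if k = 0 then
      (if (i : ℕ) = 0 then MvPolynomial.X (some (0, i)) - MvPolynomial.X none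
        else MvPolynomial.X (some (0, i)) - MvPolynomial.X (some (1, i)) * MvPolynomial.X none)
      else MvPolynomial.X (some (k, i))

/-- The affine automorphism of `F[x, v, w, z]`. [cite: Kaltofen1995, Lemma 2 (proof)] -/
def αEquiv : MvPolynomial (Option (PIdx n)) F ≃ₐ[F] MvPolynomial (Option (PIdx n)) F :=
  AlgEquiv.ofAlgHom (MvPolynomial.aeval θα) (MvPolynomial.aeval θα')
    (by
      refine MvPolynomial.algHom_ext fun v => ?_
      rcases v with _ | ⟨k, i⟩
      · simp [θα', θα]
      · by_cases hk : k = 0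
        · subst hk
          by_cases hi : (i : ℕ) = 0
          · simp [θα', θα, θ3, hi]
          · simp [θα', θα, θ3, hi]
        · simp [θα', θα, hk])
    (by
      refine MvPolynomial.algHom_ext fun v => ?_
      rcases v with _ | ⟨k, i⟩
      · simp [θα', θα]
      · by_cases hk : k = 0
        · subst hk
          by_cases hi : (i : ℕ) = 0
          · simp [θα', θα, θ3, hi]
          · simp [θα', θα, θ3, hi]
        · simp [θα', θα, hk])

/-- The automorphism composed with the renaming `Xᵢ ↦ vᵢ` is the substitution `θ3`. [folklore] -/
theorem αEquiv_rename (f : MvPolynomial (Fin n) F) :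
    αEquiv (rename (fun i => some ((0 : Fin 3), i)) f) = MvPolynomial.aeval θ3 f := by
  rw [αEquiv, AlgEquiv.ofAlgHom_apply, MvPolynomial.aeval_rename,
    show (θα ∘ fun i => some ((0 : Fin 3), i)) = (θ3 : Fin n → MvPolynomial (Option (PIdx n)) F) from
      funext fun i => by simp [θα]]

/-- `f` irreducible ⟹ `f(x + v₀, w₁x + v₁, …)` irreducible in `F[x, v, w, z]`. [cite: Kaltofen1995, Lemma 2] -/
theorem irreducible_aeval_θ3 {f : MvPolynomial (Fin n) F} (hf : Irreducible f) :
    Irreducible (MvPolynomial.aeval θ3 f : MvPolynomial (Option (PIdx n)) F) := by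
  rw [← αEquiv_rename]
  exact (MulEquiv.irreducible_iff (αEquiv : MvPolynomial (Option (PIdx n)) F ≃ₐ[F] _)).mpr
    (irreducible_rename (fun i j h => by simpa using h) hf)

/-- … hence irreducible as a polynomial in `x` over `A = F[v, w, z]`. [cite: Kaltofen1995, Lemma 2] -/
theorem irreducible_aeval_s0 {f : MvPolynomial (Fin n) F} (hf : Irreducible f) :
    Irreducible (MvPolynomial.aeval (s0 (MvPolynomial.X : PIdx n → MvPolynomial (PIdx n) F)) f) := by
  have h := irreducible_aeval_θ3 hf (n := n)
  have key : (MvPolynomial.optionEquivLeft F (PIdx n)) (MvPolynomial.aeval θ3 f) =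
      MvPolynomial.aeval (s0 (MvPolynomial.X : PIdx n → MvPolynomial (PIdx n) F)) f := by
    rw [← AlgEquiv.coe_toAlgHom, ← AlgHom.comp_apply, MvPolynomial.comp_aeval]
    have hfun : (fun i => (↑(MvPolynomial.optionEquivLeft F (PIdx n)) : MvPolynomial (Option (PIdx n)) F →ₐ[F]
        Polynomial (MvPolynomial (PIdx n) F)) (θ3 i)) =
        s0 (MvPolynomial.X : PIdx n → MvPolynomial (PIdx n) F) := by
      funext i
      unfold θ3 s0
      split_ifs <;> simp [MvPolynomial.optionEquivLeft_X_none, MvPolynomial.optionEquivLeft_X_some]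
    rw [hfun]
  rw [← key]
  exact (MulEquiv.irreducible_iff (MvPolynomial.optionEquivLeft F (PIdx n))).mpr h

/-- Naturality of `sT` under algebra maps. [folklore] -/
theorem map_sT {T T' : Type*} [CommRing T] [CommRing T'] (g : T →+* T') (p : PIdx n → T) (i : Fin n) :
    (sT p i).map (mapRingHom g) = sT (g ∘ p) i := by
  unfold sT
  split_ifs <;> simp [coe_mapRingHom]

/-- Naturality of `s0` under ring maps. [folklore] -/
theorem map_s0 {T T' : Type*} [CommRing T] [CommRing T'] (g : T →+* T') (p : PIdx n → T) (i : Fin n) :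
    (s0 p i).map g = s0 (g ∘ p) i := by
  unfold s0
  split_ifs <;> simp

/-- Naturality of `MvPolynomial.aeval` into `T[y][x]` under `F`-algebra maps. [folklore] -/
theorem map_map_aeval_sT {T T' : Type*} [CommRing T] [CommRing T'] [Algebra F T] [Algebra F T']
    (g : T →ₐ[F] T') (p : PIdx n → T) (f : MvPolynomial (Fin n) F) :
    (MvPolynomial.aeval (sT p) f).map (mapRingHom (g : T →+* T')) = MvPolynomial.aeval (sT ((g : T →+* T') ∘ p)) f := by
  have h := AlgHom.congr_fun (MvPolynomial.comp_aeval (f := sT p) (mapAlgHom (mapAlgHom g))) f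
  rw [AlgHom.comp_apply, coe_mapAlgHom, mapAlgHom_coe_ringHom] at h
  rw [h, show (fun i => (sT p i).map (mapRingHom (g : T →+* T'))) = sT ((g : T →+* T') ∘ p) from
    funext fun i => map_sT _ p i]

/-- Naturality of `MvPolynomial.aeval` into `T[y][x]` under ring maps compatible with the
`F`-algebra structures. [folklore] -/
theorem map_map_aeval_sT' {T T' : Type*} [CommRing T] [CommRing T'] [Algebra F T] [Algebra F T']
    (g : T →+* T') (hg : g.comp (algebraMap F T) = algebraMap F T') (p : PIdx n → T) (f : MvPolynomial (Fin n) F) :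
    (MvPolynomial.aeval (sT p) f).map (mapRingHom g) = MvPolynomial.aeval (sT (g ∘ p)) f := by
  have key : (mapRingHom (mapRingHom g)).comp
      (MvPolynomial.aeval (sT p) : MvPolynomial (Fin n) F →ₐ[F] Polynomial (Polynomial T)).toRingHom =
      (MvPolynomial.aeval (sT (g ∘ p)) : MvPolynomial (Fin n) F →ₐ[F] Polynomial (Polynomial T')).toRingHom := by
    refine MvPolynomial.ringHom_ext (fun c => ?_) (fun i => ?_)
    · simp only [RingHom.comp_apply, AlgHom.toRingHom_eq_coe, RingHom.coe_coe, MvPolynomial.algHom_C,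
        Polynomial.algebraMap_apply, coe_mapRingHom, Polynomial.map_C]
      have := RingHom.congr_fun hg c
      rw [RingHom.comp_apply] at this
      rw [this]
    · simp only [RingHom.comp_apply, AlgHom.toRingHom_eq_coe, RingHom.coe_coe, MvPolynomial.aeval_X,
        coe_mapRingHom, map_sT]
  exact RingHom.congr_fun key f

/-- Naturality of `MvPolynomial.aeval` into `T[x]` under `F`-algebra maps. [folklore] -/
theorem map_aeval_s0 {T T' : Type*} [CommRing T] [CommRing T'] [Algebra F T] [Algebra F T']
    (g : T →ₐ[F] T') (p : PIdx n → T) (f : MvPolynomial (Fin n) F) :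
    (MvPolynomial.aeval (s0 p) f).map (g : T →+* T') = MvPolynomial.aeval (s0 ((g : T →+* T') ∘ p)) f := by
  have h := AlgHom.congr_fun (MvPolynomial.comp_aeval (f := s0 p) (mapAlgHom g)) f
  rw [AlgHom.comp_apply, coe_mapAlgHom] at h
  rw [h, show (fun i => (s0 p i).map (g : T →+* T')) = s0 ((g : T →+* T') ∘ p) from
    funext fun i => map_s0 _ p i]

/-- `φ_p` at `y = 0` is the univariate translate. [folklore] -/
theorem map_evalRingHom_zero_aeval_sT {T : Type*} [CommRing T] [Algebra F T] (p : PIdx n → T)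
    (f : MvPolynomial (Fin n) F) :
    (MvPolynomial.aeval (sT p) f).map (evalRingHom 0) = MvPolynomial.aeval (s0 p) f := by
  set e0 : Polynomial T →ₐ[F] T := (Polynomial.aeval (0 : T) : Polynomial T →ₐ[T] T).restrictScalars F with he0
  have hce : ((e0 : Polynomial T →+* T)) = evalRingHom 0 := by
    refine Polynomial.ringHom_ext (fun q => by simp [he0]) ?_
    simp [he0, coe_evalRingHom]
  have h := AlgHom.congr_fun (MvPolynomial.comp_aeval (f := sT p) (mapAlgHom e0)) f
  rw [AlgHom.comp_apply, coe_mapAlgHom, hce] at h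
  rw [h, show (fun i => (sT p i).map (evalRingHom 0)) = s0 p from
    funext fun i => map_evalRingHom_zero_sT p i]

/-- Values of the univariate substitution at `x = 0`: the `v`-variables. [folklore] -/
theorem eval_zero_s0 {T : Type*} [CommRing T] (p : PIdx n → T) (i : Fin n) : (s0 p i).eval 0 = p (0, i) := by
  unfold s0
  split_ifs <;> simp

/-- Derivatives of the univariate substitution: `1` for `i = 0`, the slope `wᵢ` otherwise. [folklore] -/
theorem derivative_s0 {T : Type*} [CommRing T] (p : PIdx n → T) (i : Fin n) :
    derivative (s0 p i) = C (if (i : ℕ) = 0 then 1 else p (1, i)) := by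
  unfold s0
  split_ifs <;> simp

variable {m : ℕ}

/-- **The `w`-independence step** (proof of Kaltofen's Lemma 3, first case): if the `x`-derivative of
the generic translate `f(x + v₀, w₁x + v₁, …)` vanishes identically, then all partial derivatives
of `f` vanish ("resulting in a non-zero partial derivative, in contradiction …"). [cite: Kaltofen1995, Lemma 3 (proof, case ∂ψ/∂x = 0)] -/
theorem pderiv_eq_zero_of_derivative_eq_zero {f : MvPolynomial (Fin (m + 1)) F}
    (h : derivative (MvPolynomial.aeval (s0 (MvPolynomial.X : PIdx (m + 1) → MvPolynomial (PIdx (m + 1)) F)) f) = 0)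
    (i : Fin (m + 1)) : MvPolynomial.pderiv i f = 0 := by
  classical
  set A := MvPolynomial (PIdx (m + 1)) F with hA
  set pX : PIdx (m + 1) → A := MvPolynomial.X with hpX
  -- `R j := (∂ⱼ f)(v)`, a polynomial in the `v`-variables only
  set R : Fin (m + 1) → A := fun j => rename (fun l => ((0 : Fin 3), l)) (MvPolynomial.pderiv j f) with hR
  have hR' : ∀ j, (MvPolynomial.aeval (s0 pX) (MvPolynomial.pderiv j f)).eval 0 = R j := by
    intro j
    have h1 : (Polynomial.evalRingHom (0 : A)).comp
        (MvPolynomial.aeval (s0 pX) : MvPolynomial (Fin (m + 1)) F →ₐ[F] Polynomial A).toRingHom =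
        (MvPolynomial.aeval (fun l => pX (0, l)) : MvPolynomial (Fin (m + 1)) F →ₐ[F] A).toRingHom := by
      refine MvPolynomial.ringHom_ext (fun r => by simp) (fun l => ?_)
      simp [eval_zero_s0]
    have h2 := RingHom.congr_fun h1 (MvPolynomial.pderiv j f)
    simp only [RingHom.comp_apply, AlgHom.toRingHom_eq_coe, RingHom.coe_coe, coe_evalRingHom] at h2
    rw [h2, hR]
    simp only []
    rw [MvPolynomial.rename_eq_aeval, hpX]
    rfl
  -- the identity `Σ_j R_j c_j = 0`
  have hsum : ∑ j, R j * (if (j : ℕ) = 0 then 1 else pX (1, j)) = 0 := by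
    have h1 := congrArg (Polynomial.eval (0 : A)) h
    rw [derivative_aeval, eval_finsetSum, eval_zero] at h1
    rw [← h1]
    refine Finset.sum_congr rfl fun j _ => ?_
    rw [eval_mul, hR', derivative_s0, eval_C]
  -- `R j` does not involve the `w`-variables
  have hvars : ∀ j (l : Fin (m + 1)), ((1 : Fin 3), l) ∉ (R j).vars := by
    intro j l hl
    have := MvPolynomial.vars_rename _ _ hl
    simp at this
  have hR0 : ∀ j : Fin (m + 1), (j : ℕ) ≠ 0 → R j = 0 := by
    intro j hj
    have h1 := congrArg (MvPolynomial.pderiv ((1 : Fin 3), j)) hsum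
    rw [map_sum, map_zero] at h1
    rw [← h1, Finset.sum_eq_single j]
    · rw [if_neg hj, Derivation.leibniz, MvPolynomial.pderiv_eq_zero_of_notMem_vars (hvars j j), hpX,
        MvPolynomial.pderiv_X_self]
      simp
    · intro l _ hlj
      rw [Derivation.leibniz, MvPolynomial.pderiv_eq_zero_of_notMem_vars (hvars l j)]
      split_ifs
      · simp
      · rw [hpX, MvPolynomial.pderiv_X_of_ne]
        · simp
        · exact fun heq => hlj (Prod.ext_iff.mp heq).2
    · exact fun hh => (hh (Finset.mem_univ j)).elim
  have hRall : ∀ j, R j = 0 := by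
    intro j
    by_cases hj : (j : ℕ) = 0
    · have h1 := hsum
      rw [Finset.sum_eq_single j] at h1
      · rwa [if_pos hj, mul_one] at h1
      · intro l _ hlj
        have hl : (l : ℕ) ≠ 0 := fun hl0 => hlj (Fin.ext (by omega))
        rw [hR0 l hl, zero_mul]
      · exact fun hh => (hh (Finset.mem_univ j)).elim
    · exact hR0 j hj
  have hi := hRall i
  simp only [hR] at hi
  exact MvPolynomial.rename_injective (fun l : Fin (m + 1) => ((0 : Fin 3), l))
    (fun a b hab => by simpa using hab) (hi.trans (map_zero _).symm)

/-- The slopes of the univariate substitution: `1` for `i = 0`, `wᵢ` otherwise. [folklore] -/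
def slope (p : PIdx n → MvPolynomial (PIdx n) F) (i : Fin n) : MvPolynomial (PIdx n) F :=
  if (i : ℕ) = 0 then 1 else p (1, i)

/-- **The leading coefficient** `[x^d] f(x + v₀, w₁x + v₁, …) = f_d(1, w₁, …)` (Kaltofen's (30)).
[cite: Kaltofen1995, §4 (30)] -/
theorem coeff_aeval_s0 (p : PIdx n → MvPolynomial (PIdx n) F) {f : MvPolynomial (Fin n) F} {d : ℕ}
    (hf : f.totalDegree ≤ d) :
    (MvPolynomial.aeval (s0 p) f).coeff d = MvPolynomial.aeval (slope p) (MvPolynomial.homogeneousComponent d f) :=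
  coeff_aeval_affine (b := fun i => p (0, i)) (fun i => by unfold s0 slope; split_ifs <;> simp) hf

/-- The top homogeneous component of a non-zero polynomial is non-zero. [folklore] -/
theorem homogeneousComponent_totalDegree_ne_zero {σ : Type*} {f : MvPolynomial σ F} (hf : f ≠ 0) :
    MvPolynomial.homogeneousComponent f.totalDegree f ≠ 0 := by
  classical
  obtain ⟨m, hm, hmax⟩ := Finset.exists_mem_eq_sup f.support (MvPolynomial.support_nonempty.mpr hf)
    (fun s : σ →₀ ℕ => s.sum fun _ e => e)
  intro h0
  have hc := congrArg (MvPolynomial.coeff m) h0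
  rw [MvPolynomial.coeff_homogeneousComponent, MvPolynomial.coeff_zero, if_pos] at hc
  · exact (MvPolynomial.mem_support_iff.mp hm) hc
  · rw [MvPolynomial.totalDegree, hmax, Finsupp.degree_apply, Finsupp.sum]

/-- `λ = f_d(1, w) ≠ 0` for `f` of total degree `d` (over an infinite field): "Since `f` has total
degree `d`, `l` is a non-zero element in `K[w₂, …, wₙ]`". [cite: Kaltofen1995, §4 (after (30))] -/
theorem aeval_slope_homogeneousComponent_ne_zero [Infinite F] {f : MvPolynomial (Fin (m + 1)) F} {d : ℕ}
    (hf0 : f ≠ 0) (hfd : f.totalDegree = d) :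
    MvPolynomial.aeval (slope (MvPolynomial.X : PIdx (m + 1) → MvPolynomial (PIdx (m + 1)) F))
      (MvPolynomial.homogeneousComponent d f) ≠ 0 := by
  intro h0
  have hne := homogeneousComponent_totalDegree_ne_zero hf0
  rw [hfd] at hne
  refine hne (eq_zero_of_isHomogeneous_of_eval_eq_zero (MvPolynomial.homogeneousComponent_isHomogeneous d f)
    fun c hc0 => ?_)
  -- evaluate the parameters at a point with `w = c`
  set pc : PIdx (m + 1) → F := fun kl => c kl.2 with hpc
  have h1 := congrArg (MvPolynomial.aeval pc) h0
  rw [map_zero, ← AlgHom.comp_apply, MvPolynomial.comp_aeval] at h1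
  have hfun : (fun i => (MvPolynomial.aeval pc)
      (slope (MvPolynomial.X : PIdx (m + 1) → MvPolynomial (PIdx (m + 1)) F) i)) = c := by
    funext i
    unfold slope
    split_ifs with hi
    · have : i = 0 := Fin.ext hi
      rw [this, map_one, hc0]
    · simp [hpc]
  rw [hfun] at h1
  rw [← MvPolynomial.coe_aeval_eq_eval]
  exact h1

/-- **LEMMA 3 (Kaltofen), separability of the generic translate**: for `f` irreducible over an
algebraically closed field, of total degree `d ≥ 1`, the univariate polynomial
`f(x + v₀, w₁x + v₁, …) ∈ F(v, w, z)[x]` is separable ("Then if `r = 0`, `f` factors over `K̄`" —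
contrapositive). Our proof: Gauss's lemma, `Res = 0` iff `∂/∂x ≡ 0` for irreducibles, the chain rule
`∂/∂x = Σ wᵢ ∂ᵢf`, independence of the `wᵢ`, and "all `∂ᵢ f = 0`" is impossible for an irreducible
`f` over a perfect field. [cite: Kaltofen1995, Lemma 3] -/
theorem separable_map_aeval_s0 [IsAlgClosed F] {f : MvPolynomial (Fin (m + 1)) F} {d : ℕ}
    (hf : Irreducible f) (hfd : f.totalDegree = d) (hd : 0 < d) :
    ((MvPolynomial.aeval (s0 (MvPolynomial.X : PIdx (m + 1) → MvPolynomial (PIdx (m + 1)) F)) f).map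
      (algebraMap (MvPolynomial (PIdx (m + 1)) F) (FractionRing (MvPolynomial (PIdx (m + 1)) F)))).Separable := by
  classical
  set A := MvPolynomial (PIdx (m + 1)) F with hA
  set L := FractionRing A with hL
  set PA : Polynomial A := MvPolynomial.aeval (s0 (MvPolynomial.X : PIdx (m + 1) → A)) f with hPA
  have hirr : Irreducible PA := irreducible_aeval_s0 hf
  have hcoeff : PA.coeff d ≠ 0 := by
    rw [hPA, coeff_aeval_s0 _ hfd.le]
    exact aeval_slope_homogeneousComponent_ne_zero hf.ne_zero hfd
  have hdeg : PA.natDegree ≠ 0 := fun h0 => hcoeff (coeff_eq_zero_of_natDegree_lt (by omega))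
  have hprim : PA.IsPrimitive := hirr.isPrimitive hdeg
  have hirrL : Irreducible (PA.map (algebraMap A L)) :=
    (hprim.irreducible_iff_irreducible_map_fraction_map (K := L)).mp hirr
  by_contra hsep
  have hder : derivative (PA.map (algebraMap A L)) = 0 := by
    have := (separable_iff_derivative_ne_zero hirrL).not.mp hsep
    push Not at this
    exact this
  have hderA : derivative PA = 0 :=
    Polynomial.map_injective _ (IsFractionRing.injective A L) (by rw [← derivative_map, hder, Polynomial.map_zero])
  have hpd : ∀ i, MvPolynomial.pderiv i f = 0 := pderiv_eq_zero_of_derivative_eq_zero hderA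
  obtain ⟨p, hp⟩ := CharP.exists F
  rcases CharP.char_is_prime_or_zero F p with hprime | rfl
  · haveI := Fact.mk hprime
    obtain ⟨i, hi⟩ := exists_pderiv_ne_zero_of_irreducible p hf
    exact hi (hpd i)
  · haveI := CharP.charP_to_charZero F
    have hC : f = MvPolynomial.C (f.coeff 0) := eq_C_of_pderiv_eq_zero hpd
    rw [hC, MvPolynomial.totalDegree_C] at hfd
    omega

/-- `bT` commutes with ring maps. [folklore] -/
theorem bT_map {T T' : Type*} [CommRing T] [CommRing T'] (g : T →+* T') (d : ℕ) (φ : Polynomial (Polynomial T)) :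
    bT d (φ.map (mapRingHom g)) = g ∘ bT d φ := by
  ext ij
  simp only [bT, Function.comp_apply, coeff_map, coe_mapRingHom, map_mul, map_pow]

/-- The resultant `Res_{d,d}(ψ₀, ψ₀')` of `ψ₀ = genF0 d (bT d φ)` commutes with ring maps. [folklore] -/
theorem resultant_genF0_bT_map {T T' : Type*} [CommRing T] [CommRing T'] (g : T →+* T') (d : ℕ)
    (φ : Polynomial (Polynomial T)) :
    (genF0 d (bT d (φ.map (mapRingHom g)))).resultant (derivative (genF0 d (bT d (φ.map (mapRingHom g))))) d d =
      g ((genF0 d (bT d φ)).resultant (derivative (genF0 d (bT d φ))) d d) := by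
  rw [bT_map, ← map_genF0, derivative_map, resultant_map_map]

/-- Setting `y = 0` commutes with coefficient maps. [folklore] -/
theorem map_evalRingHom_zero_map_map {T T' : Type*} [CommRing T] [CommRing T'] (g : T →+* T')
    (φ : Polynomial (Polynomial T)) :
    (φ.map (mapRingHom g)).map (evalRingHom 0) = (φ.map (evalRingHom 0)).map g := by
  ext i
  rw [coeff_map, coeff_map, coeff_map, coeff_map, coe_evalRingHom, coe_evalRingHom, coe_mapRingHom,
    eval_map, eval₂_at_zero, ← coeff_zero_eq_eval_zero]

/-- The generic bivariate image `φ_gen = f(x + v₀, w₁x + z₁y + v₁, …)` over `A = F[v, w, z]`. [cite: Kaltofen1995, §5 (`φ₂`)] -/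
def φgen (f : MvPolynomial (Fin n) F) : Polynomial (Polynomial (MvPolynomial (PIdx n) F)) :=
  MvPolynomial.aeval (sT (MvPolynomial.X : PIdx n → MvPolynomial (PIdx n) F)) f

/-- Its leading coefficient `λ_A ∈ A`. [cite: Kaltofen1995, §4 (30)] -/
def lamA (f : MvPolynomial (Fin n) F) (d : ℕ) : MvPolynomial (PIdx n) F := ((φgen f).coeff d).coeff 0

/-- The resultant `Res_{d,d}(ψ₀, ψ₀') ∈ A` of `ψ₀ = genF0 d (bT d φ_gen)`. [cite: Kaltofen1995, §4 (31)] -/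
def resA (f : MvPolynomial (Fin n) F) (d : ℕ) : MvPolynomial (PIdx n) F :=
  (genF0 d (bT d (φgen f))).resultant (derivative (genF0 d (bT d (φgen f)))) d d

/-- Specialising `φ_gen` at a parameter point gives `φ_p`. [folklore] -/
theorem φgen_map_eval (f : MvPolynomial (Fin n) F) (p : PIdx n → F) :
    (φgen f).map (mapRingHom (MvPolynomial.eval p)) = MvPolynomial.aeval (sT p) f := by
  have hcomp : (MvPolynomial.eval p).comp (algebraMap F (MvPolynomial (PIdx n) F)) = algebraMap F F := by
    refine RingHom.ext fun c => ?_
    rw [RingHom.comp_apply, MvPolynomial.algebraMap_eq, MvPolynomial.eval_C, Algebra.algebraMap_self,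
      RingHom.id_apply]
  have h := map_map_aeval_sT' (MvPolynomial.eval p) hcomp (MvPolynomial.X : PIdx n → MvPolynomial (PIdx n) F) f
  have hp : ((MvPolynomial.eval p : MvPolynomial (PIdx n) F →+* F) : MvPolynomial (PIdx n) F → F) ∘
      (MvPolynomial.X : PIdx n → MvPolynomial (PIdx n) F) = p := by
    funext π
    exact MvPolynomial.eval_X _
  rw [hp] at h
  unfold φgen
  exact h

/-- `λ_A` specialises to `λ_p`. [folklore] -/
theorem eval_lamA (f : MvPolynomial (Fin n) F) (d : ℕ) (p : PIdx n → F) :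
    MvPolynomial.eval p (lamA f d) = ((MvPolynomial.aeval (sT p) f).coeff d).coeff 0 := by
  rw [lamA, ← φgen_map_eval f p, coeff_map, coe_mapRingHom, coeff_map]

/-- `Res_A` specialises to `Res_p`. [folklore] -/
theorem eval_resA (f : MvPolynomial (Fin n) F) (d : ℕ) (p : PIdx n → F) :
    MvPolynomial.eval p (resA f d) = (genF0 d (bT d (MvPolynomial.aeval (sT p) f))).resultant
      (derivative (genF0 d (bT d (MvPolynomial.aeval (sT p) f)))) d d := by
  rw [resA, ← φgen_map_eval f p, resultant_genF0_bT_map]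

/-- `λ_A ≠ 0` for `f` of total degree `d`. [cite: Kaltofen1995, §4 (after (30))] -/
theorem lamA_ne_zero [Infinite F] {f : MvPolynomial (Fin (m + 1)) F} {d : ℕ} (hf0 : f ≠ 0)
    (hfd : f.totalDegree = d) : lamA f d ≠ 0 := by
  have h1 : lamA f d = (MvPolynomial.aeval (s0 (MvPolynomial.X : PIdx (m + 1) →
      MvPolynomial (PIdx (m + 1)) F)) f).coeff d := by
    rw [lamA, ← map_evalRingHom_zero_aeval_sT, coeff_map, coe_evalRingHom, ← coeff_zero_eq_eval_zero, φgen]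
  rw [h1, coeff_aeval_s0 _ hfd.le]
  exact aeval_slope_homogeneousComponent_ne_zero hf0 hfd

/-- `Res_A ≠ 0` for `f` irreducible of total degree `d ≥ 1` over an algebraically closed field
(through the generic point over `L = Frac A` and Lemma 3). [cite: Kaltofen1995, Lemma 4] -/
theorem resA_ne_zero [IsAlgClosed F] {f : MvPolynomial (Fin (m + 1)) F} {d : ℕ} (hf : Irreducible f)
    (hfd : f.totalDegree = d) (hd : 0 < d) : resA f d ≠ 0 := by
  classical
  have hιinj : Function.Injective (algebraMap (MvPolynomial (PIdx (m + 1)) F)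
      (FractionRing (MvPolynomial (PIdx (m + 1)) F))) := IsFractionRing.injective _ _
  have hcomp : (algebraMap (MvPolynomial (PIdx (m + 1)) F) (FractionRing (MvPolynomial (PIdx (m + 1)) F))).comp
      (algebraMap F (MvPolynomial (PIdx (m + 1)) F)) = algebraMap F (FractionRing (MvPolynomial (PIdx (m + 1)) F)) :=
    (IsScalarTower.algebraMap_eq F (MvPolynomial (PIdx (m + 1)) F) _).symm
  -- the generic bivariate image over `L`
  have hφLmap := map_map_aeval_sT' _ hcomp (MvPolynomial.X : PIdx (m + 1) → MvPolynomial (PIdx (m + 1)) F) f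
  rw [← φgen] at hφLmap
  have hTD : TDeg (MvPolynomial.aeval (sT ((algebraMap (MvPolynomial (PIdx (m + 1)) F)
      (FractionRing (MvPolynomial (PIdx (m + 1)) F))) ∘ MvPolynomial.X)) f) d := by
    have h := TDeg_aeval_sT (p := ((algebraMap (MvPolynomial (PIdx (m + 1)) F)
      (FractionRing (MvPolynomial (PIdx (m + 1)) F))) ∘ MvPolynomial.X)) f
    rwa [hfd] at h
  have hlamL : ((MvPolynomial.aeval (sT ((algebraMap (MvPolynomial (PIdx (m + 1)) F)
      (FractionRing (MvPolynomial (PIdx (m + 1)) F))) ∘ MvPolynomial.X)) f).coeff d).coeff 0 ≠ 0 := by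
    rw [← hφLmap, coeff_map, coe_mapRingHom, coeff_map]
    intro h0
    exact lamA_ne_zero hf.ne_zero hfd (hιinj (by rw [map_zero]; exact h0))
  have hsepL : ((MvPolynomial.aeval (sT ((algebraMap (MvPolynomial (PIdx (m + 1)) F)
      (FractionRing (MvPolynomial (PIdx (m + 1)) F))) ∘ MvPolynomial.X)) f).map (evalRingHom 0)).Separable := by
    rw [← hφLmap, map_evalRingHom_zero_map_map, φgen, map_evalRingHom_zero_aeval_sT]
    exact separable_map_aeval_s0 hf hfd hd
  have hgen := congrArg (Polynomial.map (evalRingHom 0)) (psi_bT_eq hd hTD hlamL)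
  rw [map_evalRingHom_zero_psi, Polynomial.map_mul, Polynomial.map_C, coe_evalRingHom, eval_C,
    Polynomial.map_comp, Polynomial.map_mul, Polynomial.map_C, coe_evalRingHom, eval_C, map_X] at hgen
  have hsepgen := separable_C_mul_comp_C_mul_X hsepL (pow_ne_zero (d - 1) hlamL) (inv_ne_zero hlamL)
  rw [← hgen] at hsepgen
  have hRL := (resultant_dd_ne_zero_iff_separable (monic_genF0 d _) (natDegree_genF0 d _) hd).mpr hsepgen
  rw [← hφLmap, resultant_genF0_bT_map] at hRL
  intro h0
  apply hRL
  rw [← resA, h0, map_zero]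

/-- **Kaltofen's Lemma 4, existence part** ("There exists a non-zero polynomial `Υ` … such that
`Υ(ν, ω) ≠ 0` implies `ldcf_x(χ) ∈ K̄` and `Res_x(χ(x,0,z), ∂χ(x,0,z)/∂x) ≠ 0`"), in the form we
need: for `f` irreducible of total degree `d ≥ 1` over an algebraically closed field there is a
parameter point `p = (ν, ω, η)` at which `λ = [x^d] φ_p ≠ 0` and `ψ_p(x, 0) = genF0 d (bT d φ_p)` is
separable. [cite: Kaltofen1995, Lemma 4] -/
theorem exists_point_separable [IsAlgClosed F] {f : MvPolynomial (Fin (m + 1)) F} {d : ℕ}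
    (hf : Irreducible f) (hfd : f.totalDegree = d) (hd : 0 < d) :
    ∃ p : PIdx (m + 1) → F, ((MvPolynomial.aeval (sT p) f).coeff d).coeff 0 ≠ 0 ∧
      (genF0 d (bT d (MvPolynomial.aeval (sT p) f))).Separable := by
  classical
  obtain ⟨pt, hpt⟩ : ∃ pt : PIdx (m + 1) → F, MvPolynomial.eval pt (lamA f d * resA f d) ≠ 0 := by
    by_contra hall
    push Not at hall
    exact (mul_ne_zero (lamA_ne_zero hf.ne_zero hfd) (resA_ne_zero hf hfd hd))
      (MvPolynomial.funext fun pt => by rw [hall pt, map_zero])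
  rw [map_mul, eval_lamA, eval_resA] at hpt
  exact ⟨pt, left_ne_zero_of_mul hpt,
    (resultant_dd_ne_zero_iff_separable (monic_genF0 d _) (natDegree_genF0 d _) hd).mp (right_ne_zero_of_mul hpt)⟩

end Lemma3

end Literature.RingTheory.MvPolynomial.NoetherForms
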